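import Mathlib
import Summits.Ventures.PercRepro2.CoinChainXAJpDarc
import Summits.Ventures.PercRepro2.CoinChainXAGeneralGateDarc
import Summits.Ventures.PercRepro2.CoinOrTailLsmCore

/-!
# Row 2′DARC at the AND-switch chain with one sure entry and two coin entries, for EVERY pair of entry markers
(blind cell PercRepro2, night-2 g29; proofs/NIGHT2-DARC.md §71.4)

`darc_of_chain_two_coins_entry_markers`: the general chain (`a` entered from the sure entry `m ∈ U` and from `a'` by
the coin, `a'` entered from `{j, j'} ⊆ U` surely; chain data `ν = P(level)`, `c = chainC`, `d = chainD`, `d' = chainD'`;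
an lsm core; positive world masses, ideal mass and coin-law masses on the fibres `mjj'`, `jj'`) satisfies
`DARC pr arcs s {t} m₁ m₂ a w` for EVERY pair of DISTINCT markers `m₁, m₂ ∈ {m, j, j'}` — the pairs `(m, j)`, `(m, j')`
by `darc_of_chain_six_general` (g28, any coin-entered set containing the marked coin entry), the pair `(j, j')` by
`darc_of_chain_jp` (the two sign families of `γ_m`), and their mirrors by `DARC.symm`.
-/

namespace Summit.Ventures.PercRepro2.Coin

open Classical

section JpEntryMarkers

variable {V : Type*} {E : Type*} [Fintype V] [DecidableEq V] [Fintype E] [DecidableEq E]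
  {R : Type*} [Field R] [LinearOrder R] [IsStrictOrderedRing R]
  {arcs : E → Finset (V × V)} {s : V} {U : Finset V} {c' c : V → E}
  {a' a w : V}

/-- **ROW 2′DARC AT THE AND-SWITCH CHAIN WITH ONE SURE ENTRY `m` AND TWO COIN ENTRIES `{j, j'}`, FOR EVERY PAIR OF
DISTINCT ENTRY MARKERS** (chain data, lsm core, positive world masses, ideal mass and coin-law masses on the fibres
`mjj'`, `jj'`; every admissible gate). -/
theorem darc_of_chain_two_coins_entry_markers (pr : E → R) (hp : IsProbVec pr) (hS : SameEnds arcs)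
    {m j j' : V}
    (h' : OrTailK arcs s U {j, j'} c' a') (hsure' : ∀ r ∈ ({j, j'} : Finset V), pr (c' r) = 1)
    (h : OrTailK arcs s (insert a' U) (insert a' {m}) c a) (hsure : pr (c m) = 1)
    (hm : m ∈ U) (hjU : j ∈ U) (hj'U : j' ∈ U)
    (hν : ∀ W W', W ⊆ U → W' ⊆ U →
      prob pr (coreLevel arcs s U W) * prob pr (coreLevel arcs s U W') ≤
        prob pr (coreLevel arcs s U (W ∩ W')) * prob pr (coreLevel arcs s U (W ∪ W')))
    {t : V} (htC : t ∉ insert a (insert a' U)) (hts : t ≠ s) (hws : w ≠ s)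
    (hwC : w ∉ insert a (insert a' U))
    (hpos0 : 0 < ∑ W ∈ U.powerset, prob pr (coreLevel arcs s U W) *
      chainMix {m} {j, j'} 0 (chainC pr arcs s t U {j, j'} a' a) (chainD pr arcs s t U {j, j'} a' a) W)
    (hpos1 : 0 < ∑ W ∈ U.powerset, prob pr (coreLevel arcs s U W) *
      chainMix {m} {j, j'} 1 (chainC pr arcs s t U {j, j'} a' a) (chainD pr arcs s t U {j, j'} a' a) W)
    (hmI : 0 < ∑ W ∈ U.powerset.filter (fun W => ¬ ∃ r ∈ ({m} : Finset V) ∪ {j, j'}, r ∈ W),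
      prob pr (coreLevel arcs s U W) * chainC pr arcs s t U {j, j'} a' a W)
    (hU : 0 < ∑ W ∈ U.powerset.filter (fun W => m ∈ W ∧ j ∈ W ∧ j' ∈ W),
      prob pr (coreLevel arcs s U W) * chainD pr arcs s t U {j, j'} a' a W)
    (hJJ : 0 < ∑ W ∈ U.powerset.filter (fun W => m ∉ W ∧ j ∈ W ∧ j' ∈ W),
      prob pr (coreLevel arcs s U W) * chainD pr arcs s t U {j, j'} a' a W)
    {m₁ m₂ : V} (hm₁ : m₁ ∈ ({m, j, j'} : Finset V)) (hm₂ : m₂ ∈ ({m, j, j'} : Finset V)) (hne : m₁ ≠ m₂) :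
    DARC pr arcs s {t} m₁ m₂ a w := by
  have hj : j ∈ ({j, j'} : Finset V) := Finset.mem_insert_self _ _
  have hj' : j' ∈ ({j, j'} : Finset V) := Finset.mem_insert_of_mem (Finset.mem_singleton_self _)
  have hmj : DARC pr arcs s {t} m j a w :=
    darc_of_chain_six_general pr hp hS h' hsure' hj h hsure hm hjU hν htC hts hws hwC hpos0 hpos1 hmI
  have hmj' : DARC pr arcs s {t} m j' a w :=
    darc_of_chain_six_general pr hp hS h' hsure' hj' h hsure hm hj'U hν htC hts hws hwC hpos0 hpos1 hmI
  have hjj' : DARC pr arcs s {t} j j' a w :=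
    darc_of_chain_jp pr hp hS h' hsure' h hsure hm hjU hj'U hν htC hts hws hwC hpos0 hpos1 hmI hU hJJ
  simp only [Finset.mem_insert, Finset.mem_singleton] at hm₁ hm₂
  rcases hm₁ with rfl | rfl | rfl <;> rcases hm₂ with rfl | rfl | rfl
  · exact absurd rfl hne
  · exact hmj
  · exact hmj'
  · exact DARC.symm pr hmj
  · exact absurd rfl hne
  · exact hjj'
  · exact DARC.symm pr hmj'
  · exact DARC.symm pr hjj'
  · exact absurd rfl hne

end JpEntryMarkers

end Summit.Ventures.PercRepro2.Coin
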